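import Literature.NumberTheory.Automorphic.UnitaryCurveCohCotangentForms
import Literature.NumberTheory.Automorphic.UnitaryGroupAdelicProduct
import HarnessLib

/-!
# Cone-holomorphic cotangent automorphic forms of `U(J)`, `J ∈ M₂(E)`, are CONTINUOUS on `U(J)(𝔸_F)`

Topic `NumberTheory/Automorphic`; namespace `Literature.NumberTheory.Automorphic.UnitaryCurveForms` (the carriers' namespace).  Theorems
only (no definition, no named fact, no instance, no `sorry`); imports ★ `UnitaryCurveCohCotangentForms` (the rank-2 cone carriers
`holCotForms₂ … 𝔣`, `cohForms₂`, `conjFun₂`, `ConeFrame`, `IsConeHol`; p793416) + ★ `UnitaryGroupAdelicProduct` (`archPart`, `finPart`,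
`archToAdelic_mul_finAdelicToAdelic`, `commute_archToAdelic_finAdelicToAdelic`).

A member `f` of `holCotForms₂ F E c J hc hfix w₁ 𝔣` is, by definition, (Kc) right-invariant under the archimedean factor AWAY from `w₁`, (Sm)
right-invariant under an OPEN subgroup `K_f` of `U(J)(𝔸_{F,f})`, and (H) its (right) `w₁`-slice through every adelic point `x₁`,
`u ↦ f (x₁ · adelicSingle w₁ u)` (tree ed. 2 of the carrier, p794499), is the restriction to `U(σ_{w₁}J)(ℂ)` of a function `Φ` on `M₂(ℂ)` that is complex-differentiable — hence
continuous — on the cone-open `{g | g invertible, g v₀ negative}`, which CONTAINS `U(σ_{w₁}J)(ℂ)` (isometries preserve the negative cone,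
`mulVec_mem_negCone_of_mem_archLocal`).  Writing an adelic point as `x = (1, x_f) · adelicSingle w₁ (x_∞)_{w₁} · k` with `k` in the factor away
from `w₁` (★ `exists_eq_archSingle_mul`, ★ `archToAdelic_mul_finAdelicToAdelic`, and the commutations ★ `commute_archToAdelic_finAdelicToAdelic`,
★ `adelicSingle_mul_eq_mul_of_mem_map_ker_archAt`, ★ `adelicSingle_mul_finAdelicToAdelic`), clauses (Kc) and (Sm) show that on the OPEN
neighbourhood `{x | x_f ∈ x₀,f · K_f}` of `x₀` the form `f` equals `x ↦ Φ((x_∞)_{w₁})` for the `Φ` of (H) at `x₁ := (1, x₀,f)` — a continuous function of `x`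
(★ `continuous_archPart`, ★ `continuous_archAt`).  Hence:

* `mulVec_mem_negCone_of_mem_archLocal` — `U(σ_w J)(ℂ)` preserves the negative cone of `σ_w J`;
* `IsConeHol.continuous_comp_archLocal` — a cone-holomorphic `Φ` is continuous along `U(σ_{w₁}J)(ℂ)`;
* `apply_eq_apply_finAdelicToAdelic_mul_adelicSingle` — for `f ∈ holCotForms₂`: `f x = f ((1, x_f) · adelicSingle w₁ (x_∞)_{w₁})`;
* **`continuous_of_mem_holCotForms₂`** — every `f ∈ holCotForms₂ … 𝔣` is continuous on `U(J)(𝔸_F)`;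
* `continuous_of_mem_map_conjFun₂`, `continuous_of_mem_cohForms₂` — the same for the antiholomorphic forms and for `cohForms₂ = hol ⊔ conj hol`.

This discharges the continuity hypothesis `hcont` of the floor-0 P5 folds (F0P5-p03 (g0) `stub_X_of_letters` (C₂); the `S1bSignedExclusion`
closer): the `L²`-classes `MemLp.toLp (toQuotFun 𝒰 f)` of cone forms on the compact quotient exist for ALL members of the carrier, not only for the
realised ones ([BorelJacquet1979, §4.2–§4.3]: automorphic forms are smooth, in particular continuous, functions on `G(𝔸)`; [Borel1997, §5.14]).
Cell `hodgecm-mathlib`, floor-0 programme P5 (`F0_AlbCm`, stub `stub_S1_betti` slice and `stub_S1b_hodge`), seat F0P5-p02 (g0).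
HC_CM is proved only modulo the printed citations until rung 0 closes; this file discharges none of them.

## References
* [BorelJacquet1979] A. Borel, H. Jacquet, *Automorphic forms and automorphic representations*, Corvallis PSPM 33.1 (1979), §4.1 (`G(𝔸) =
  G_∞ × G(𝔸_f)`), §4.2–§4.3 (smoothness of automorphic forms).
* [Borel1997] A. Borel, *Automorphic forms on SL₂(ℝ)*, Cambridge Tracts 130 (1997), §5.13–§5.14 (forms as functions on the group).
-/

noncomputable section

open NumberField NumberField.InfinitePlace Topology Matrix Filter

open scoped Matrix MatrixGroups ComplexConjugate ComplexOrder Topology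

namespace Literature.NumberTheory.Automorphic

namespace UnitaryCurveForms

open UnitaryGroup Literature.AlgebraicGeometry.ShimuraVarieties

variable (F E : Type) [Field F] [NumberField F] [Field E] [NumberField E] [Algebra F E]
  (c : E ≃ₐ[F] E) (J : Matrix (Fin 2) (Fin 2) E)
  (hc : c ≠ 1) (hfix : ∀ w : InfinitePlace E, c • w = w) (w₁ : {w : InfinitePlace E // IsComplex w})

/-! ## §1 Isometries preserve the negative cone; cone-holomorphic functions are continuous along `U(σ_{w₁}J)(ℂ)` -/

omit [NumberField E] in
/-- An element of `U(σ_w J)(ℂ) = archLocal E 2 J w` maps the negative cone of `σ_w J` into itself (it preserves the hermitian form).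
[cite: BergeronMillsonMoeglin2016Balls, Part 2 §1.3] -/
theorem mulVec_mem_negCone_of_mem_archLocal (u : archLocal E 2 J w₁) {v : Fin 2 → ℂ}
    (hv : v ∈ negCone (J.map w₁.1.embedding)) :
    ((u : GL (Fin 2) ℂ) : Matrix (Fin 2) (Fin 2) ℂ) *ᵥ v ∈ negCone (J.map w₁.1.embedding) := by
  have hu := mem_unitaryGroupOfForm_iff.1 u.2
  set M : Matrix (Fin 2) (Fin 2) ℂ := ((u : GL (Fin 2) ℂ) : Matrix (Fin 2) (Fin 2) ℂ) with hM
  have hMH : (M.map (starRingEnd ℂ))ᵀ = Mᴴ := by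
    ext i j
    rfl
  rw [mem_negCone_iff] at hv ⊢
  have key : star (M *ᵥ v) ⬝ᵥ (J.map w₁.1.embedding *ᵥ (M *ᵥ v)) = star v ⬝ᵥ (J.map w₁.1.embedding *ᵥ v) := by
    rw [star_mulVec, mulVec_mulVec, dotProduct_mulVec, vecMul_vecMul, ← Matrix.mul_assoc, ← hMH, hu,
      ← dotProduct_mulVec]
  rw [key]
  exact hv

omit [NumberField E] in
/-- A cone-holomorphic function `Φ` (`IsConeHol 𝔣 Φ`: complex-differentiable on the cone-open `{g | g invertible, g v₀ negative}`) is
continuous along the subgroup `U(σ_{w₁}J)(ℂ)`, which lies in the cone-open. [cite: Borel1997, §5.13–§5.14] -/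
theorem IsConeHol.continuous_comp_archLocal {𝔣 : ConeFrame E J w₁} {Φ : Matrix (Fin 2) (Fin 2) ℂ → ℂ} (hΦ : IsConeHol 𝔣 Φ) :
    Continuous fun u : archLocal E 2 J w₁ => Φ ((u : GL (Fin 2) ℂ) : Matrix (Fin 2) (Fin 2) ℂ) := by
  have hψ : Continuous fun u : archLocal E 2 J w₁ => (((u : GL (Fin 2) ℂ) : Matrix (Fin 2) (Fin 2) ℂ) : Fin 2 → Fin 2 → ℂ) :=
    Units.continuous_val.comp continuous_subtype_val
  have h := hΦ.1.continuousOn.comp_continuous hψ fun u =>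
    ⟨Units.isUnit (u : GL (Fin 2) ℂ), mulVec_mem_negCone_of_mem_archLocal E J w₁ u 𝔣.v₀_mem⟩
  exact h

/-! ## §2 Reduction of a form to its `w₁`- and finite components -/

/-- For `f ∈ holCotForms₂ … 𝔣` and any adelic point `x`: `f x = f ((1, x_f) · adelicSingle w₁ (x_∞)_{w₁})` — the archimedean part of `x` away
from `w₁` is moved to the far right (it commutes with the finite factor and with the `w₁`-factor) and absorbed by the right `K_c`-invariance (Kc)
(★ `exists_eq_archSingle_mul`, ★ `archToAdelic_mul_finAdelicToAdelic`). [cite: BorelJacquet1979, §4.1] -/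
theorem apply_eq_apply_finAdelicToAdelic_mul_adelicSingle (𝔣 : ConeFrame E J w₁)
    {f : (adelicGroupData F E c 2 J).Adelic → ℂ} (hf : f ∈ holCotForms₂ F E c J hc hfix w₁ 𝔣)
    (x : (adelicGroupData F E c 2 J).Adelic) :
    f x = f (finAdelicToAdelic F E c 2 J (finPart F E c 2 J x) *
      adelicSingle F E c 2 J hc hfix w₁ (archAt F E c 2 J w₁ (hfix w₁.1) hc (archPart F E c 2 J x))) := by
  obtain ⟨-, hK, -, -⟩ := hf
  obtain ⟨a', ha', h⟩ := exists_eq_archSingle_mul F E c 2 J hc hfix w₁ (archPart F E c 2 J x)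
  have hk : archToAdelic F E c 2 J a' ∈ ((archAt F E c 2 J w₁ (hfix w₁.1) hc).ker).map (archToAdelic F E c 2 J) :=
    Subgroup.mem_map.2 ⟨a', MonoidHom.mem_ker.2 ha', rfl⟩
  -- `(x_∞, 1) = adelicSingle w₁ (x_∞)_{w₁} · (a', 1)`
  have h2 : archToAdelic F E c 2 J (archPart F E c 2 J x) =
      adelicSingle F E c 2 J hc hfix w₁ (archAt F E c 2 J w₁ (hfix w₁.1) hc (archPart F E c 2 J x)) *
        archToAdelic F E c 2 J a' := by
    conv_lhs => rw [h]
    rw [map_mul, adelicSingle_apply]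
  -- `x = (1, x_f) · adelicSingle w₁ (x_∞)_{w₁} · (a', 1)`
  have hx : x = finAdelicToAdelic F E c 2 J (finPart F E c 2 J x) *
      adelicSingle F E c 2 J hc hfix w₁ (archAt F E c 2 J w₁ (hfix w₁.1) hc (archPart F E c 2 J x)) *
        archToAdelic F E c 2 J a' := by
    have e1 := archToAdelic_mul_finAdelicToAdelic F E c 2 J x
    have e2 := (commute_archToAdelic_finAdelicToAdelic F E c 2 J (archPart F E c 2 J x) (finPart F E c 2 J x)).eq
    rw [mul_assoc, ← h2, ← e2, e1]
  rw [congrArg f hx]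
  exact hK _ hk _

/-! ## §3 Continuity -/

/-- **Every cone-holomorphic cotangent automorphic form is continuous on `U(J)(𝔸_F)`.**  On the open neighbourhood `{x | x_f ∈ x₀,f · K_f}` of
`x₀` (`K_f` the open subgroup of clause (Sm)), `f` coincides with `x ↦ Φ((x_∞)_{w₁})` for the cone-holomorphic `Φ` of clause (H) at the point
`(1, x₀,f)` (right `w₁`-slice, carrier ed. 2), a continuous function of `x`. [cite: BorelJacquet1979, §4.2–§4.3] [cite: Borel1997, §5.14] -/
theorem continuous_of_mem_holCotForms₂ (𝔣 : ConeFrame E J w₁) {f : (adelicGroupData F E c 2 J).Adelic → ℂ}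
    (hf : f ∈ holCotForms₂ F E c J hc hfix w₁ 𝔣) : Continuous f := by
  have hf' := hf
  obtain ⟨-, -, ⟨Kf, hKo, hKf⟩, hH⟩ := hf'
  refine continuous_iff_continuousAt.2 fun x₀ => ?_
  set k₀ := finPart F E c 2 J x₀ with hk₀
  obtain ⟨Φ, hΦ, hΦf⟩ := hH (finAdelicToAdelic F E c 2 J k₀)
  -- the continuous local model `x ↦ Φ((x_∞)_{w₁})`
  have hg : Continuous fun x : (adelicGroupData F E c 2 J).Adelic =>
      Φ (((archAt F E c 2 J w₁ (hfix w₁.1) hc (archPart F E c 2 J x) : archLocal E 2 J w₁) : GL (Fin 2) ℂ) :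
        Matrix (Fin 2) (Fin 2) ℂ) :=
    (hΦ.continuous_comp_archLocal E J w₁).comp ((continuous_archAt F E c 2 J w₁ (hfix w₁.1) hc).comp (continuous_archPart F E c 2 J))
  refine hg.continuousAt.congr ?_
  -- the open neighbourhood `{x | x₀,f⁻¹ · x_f ∈ K_f}` of `x₀`
  have hU : IsOpen {x : (adelicGroupData F E c 2 J).Adelic | k₀⁻¹ * finPart F E c 2 J x ∈ (Kf : Set (finAdelic F E c 2 J))} :=
    hKo.preimage (continuous_const.mul (continuous_finPart F E c 2 J))
  have hx₀ : x₀ ∈ {x : (adelicGroupData F E c 2 J).Adelic | k₀⁻¹ * finPart F E c 2 J x ∈ (Kf : Set (finAdelic F E c 2 J))} := by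
    simp only [Set.mem_setOf_eq, hk₀, inv_mul_cancel, SetLike.mem_coe]
    exact Kf.one_mem
  filter_upwards [hU.mem_nhds hx₀] with x hx
  rw [apply_eq_apply_finAdelicToAdelic_mul_adelicSingle F E c J hc hfix w₁ 𝔣 hf x]
  have hsplit : finAdelicToAdelic F E c 2 J (finPart F E c 2 J x) =
      finAdelicToAdelic F E c 2 J k₀ * finAdelicToAdelic F E c 2 J (k₀⁻¹ * finPart F E c 2 J x) := by
    rw [← map_mul, mul_inv_cancel_left]
  rw [hsplit, mul_assoc, ← adelicSingle_mul_finAdelicToAdelic F E c 2 J hc hfix w₁, ← mul_assoc, hKf _ hx, hΦf]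

/-- The complex conjugate of a continuous form is continuous: members of the `conjFun₂`-image of `holCotForms₂` (the antiholomorphic cotangent
forms) are continuous. [cite: BorelJacquet1979, §4.2–§4.3] -/
theorem continuous_of_mem_map_conjFun₂ (𝔣 : ConeFrame E J w₁) {f : (adelicGroupData F E c 2 J).Adelic → ℂ}
    (hf : f ∈ (holCotForms₂ F E c J hc hfix w₁ 𝔣).map (conjFun₂ F E c J)) : Continuous f := by
  obtain ⟨f₀, hf₀, rfl⟩ := Submodule.mem_map.1 hf
  exact (continuous_of_mem_holCotForms₂ F E c J hc hfix w₁ 𝔣 hf₀).star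

/-- Members of `cohForms₂ = holCotForms₂ ⊔ conj holCotForms₂` (the `(1,0) ⊕ (0,1)` cotangent forms) are continuous. [cite: BorelJacquet1979, §4.2–§4.3]
[cite: BorelWallach2000, VII 2.10 and 3.6] -/
theorem continuous_of_mem_cohForms₂ (𝔣 : ConeFrame E J w₁) {f : (adelicGroupData F E c 2 J).Adelic → ℂ}
    (hf : f ∈ cohForms₂ F E c J hc hfix w₁ 𝔣) : Continuous f := by
  obtain ⟨f₁, hf₁, f₂, hf₂, rfl⟩ := Submodule.mem_sup.1 hf
  exact (continuous_of_mem_holCotForms₂ F E c J hc hfix w₁ 𝔣 hf₁).add (continuous_of_mem_map_conjFun₂ F E c J hc hfix w₁ 𝔣 hf₂)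

end UnitaryCurveForms

end Literature.NumberTheory.Automorphic

end
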